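import Summits.BirchSwinnertonDyer.BirchSwinnertonDyer.Theses.PrintX10b
import Summits.BirchSwinnertonDyer.BirchSwinnertonDyer.Theorems.PrintX10bTwoSidedLinkAnyClassNumberX10bPinnedOfPrint
import Summits.BirchSwinnertonDyer.BirchSwinnertonDyer.Theorems.PrintX10bHowardContainmentAnyClassNumberX10bThm413Hyp
import HarnessLib

/-!
# PrintX10b aside stmt-BirchSwinnertonDyer-23730 `TwoSidedLinkAnyClassNumberX10b` (B₃, untied) —
# SUPERSESSION CERTIFICATE BY NAME: the untied B₃ follows from the PINNED twins, hence from the route's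
# own `closes` binders; and its `3 ∤ h_K` slice follows from print

The rev-19 crux `TwoSidedLinkAnyClassNumberX10b` (23730) grants an UNTIED containment
`∃ jbar D F X, I(ℋ_F)² ⊆ char_Λ(X_tors)` (the family `F` carries its own parametrisation datum `F.Dt`, so the
hypothesis is `μ`-blind under rescaling — PIN-1 / REF-104) and concludes the two-sided link
`X11b.IMCWaldspurgerOnTreeGoodAt p κ (inducedPlace ι) γ ι P`; it was retriaged to an aside at rev 22 and its
decl is frozen. This file records, as kernel theorems against the frozen decl, WHY no separate work is ever owed
on it:

* `twoSidedLinkAnyClassNumberX10b_of_pinnedTwins` — `HowardContainmentAnyClassNumberX10bPinned` (A₃^pin, 26621)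
  and `TwoSidedLinkAnyClassNumberX10bPinned` (B₃^pin, 26622) together give 23730: on a B₃ frame `d_K` is odd,
  hence `≠ -4`, so A₃^pin supplies the TIED containment for the frame's own `Dt`, and B₃^pin consumes it; the
  untied hypothesis of 23730 is simply discarded.
* `twoSidedLinkAnyClassNumberX10bPinned_of_untied` — conversely 23730 ⟹ B₃^pin (drop the tie): granted A₃^pin
  the untied and the pinned B-statements are EQUIVALENT.
* `twoSidedLinkAnyClassNumberX10b_of_pinnedContainment_of_printFacts` — the same with B₃^pin replaced by its
  landed door (`PrintX10bPinned.twoSidedLinkAnyClassNumberX10bPinnedOfPrint_holds`, p613989): 23730 follows from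
  A₃^pin and the two print bundles `PinnedTransferPrintFacts`, `HeegnerPrintFactsX10b`.
* `twoSidedLinkAnyClassNumberX10b_of_closesBinders` — 23730 from EXACTLY the binders of the route's `closes`
  (rev 21): `hMZ hCGLS hTw` feeding the deciding crux `HowardContainmentAnyClassNumberX10bPinnedOfPrint` (26623),
  plus `hPT hHP`. So 23730 lies in the cone of the deciding crux: it closes BY NAME the moment 26623 does.
* `twoSidedLinkAnyClassNumberX10b_coprimeClassNumber_of_printFacts` — the `3 ∤ h_K` slice of 23730 from PRINT
  alone (modulo the cite-only bundles the route already binds): Mastella–Zerman 2026 Cor. 4.6 gives the pinned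
  containment there (`X10.heegnerContainmentPinned_of_cor46_of_not_surj`, p607508), the door does the rest.
  What 23730 asks beyond this slice is the `3 ∣ h_K` pinned containment — the open A-side content — and
  nothing on the B side.

* Appended §(LIGHT): the same for the rev-33 LIGHT A-side `HowardContainmentLightFrameX10bPinned` (27274) and the
  new deciding crux `HowardContainmentLightFrameX10bPinnedOfPrint` (27275): route-text-free, by name, and from the
  rev-33 `closes` binders.

Cell `run/shared/lean/pub/bsd-print-x9/`, seat `bsd-line-x10b-p3` (gen 3; D-0154 row 10). HONEST FRAMING: glue
theorems over named items / print bundles (`--supports` the aside 23730); nothing is closed by this file; the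
deciding crux (26623, x10b-p2) is untouched; no summit statement is proved by this seat; BSD is not proved by any
of this.

References: [MastellaZerman2026] Cor. 4.6; [YanZhu2024MainConjNonCM] Thm. 5.7 (1), Thm. 5.9;
[BurungaleCastellaSkinner2025] Prop. 4.2.2; [CastellaGrossiLeeSkinner2022] Thm. 4.1.3, Thm. 5.1.3;
[JetchevSkinnerWan2017] Thm. 3.3.1.
-/

-- the summit and its single problem are both named `BirchSwinnertonDyer` (registry layout D-0017)
set_option linter.dupNamespace false

namespace Summit.BirchSwinnertonDyer.BirchSwinnertonDyer.Theorems.PrintX10bPinned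

open Summit.BirchSwinnertonDyer.BirchSwinnertonDyer.Theses.PrintX10b
open Summit.BirchSwinnertonDyer.BirchSwinnertonDyer.Rank1Residual

-- `IsOfFinAddOrder P` / `Point.map` in the frozen decl elaborate the point group through `DecidableEq K`
-- (route file context); mirror it here.
open scoped Classical

/-- Some embedding of an algebraic closure of `K` into `ℂ` extending a given `ιC : K →+* ℂ` exists
(`IsAlgClosed.lift`; only its existence is used). -/
private theorem nonempty_ringHom_algebraicClosure_complex (K : Type) [Field K] (ιC : K →+* ℂ) :
    Nonempty (AlgebraicClosure K →+* ℂ) := by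
  letI : Algebra K ℂ := ιC.toAlgebra
  exact ⟨(IsAlgClosed.lift (R := K) (M := ℂ) (S := AlgebraicClosure K)).toRingHom⟩

/-- Odd discriminants are not `-4`. -/
private theorem discr_ne_neg_four_of_odd {d : ℤ} (hodd : Odd d) : d ≠ -4 := by
  rintro rfl
  exact absurd hodd (by decide)

/-- **23730 from the pinned twins.** `HowardContainmentAnyClassNumberX10bPinned` (stmt-26621, A₃^pin: the TIED
containment `∃ jbar D F X, F.Dt = Dt ∧ I(ℋ_F)² ⊆ char_Λ(X_tors)` on every X10b Heegner frame with `p ∤ c(Dt)`)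
and `TwoSidedLinkAnyClassNumberX10bPinned` (stmt-26622, B₃^pin) imply the untied aside
`TwoSidedLinkAnyClassNumberX10b` (stmt-23730): the untied `∃`-hypothesis is discarded, `Odd d_K` gives
`d_K ≠ -4`, and `[Fact (κ.IsTopGenerator γ)]` is unwrapped for A₃^pin. Pure glue. -/
theorem twoSidedLinkAnyClassNumberX10b_of_pinnedTwins
    (hA : HowardContainmentAnyClassNumberX10bPinned) (hB : TwoSidedLinkAnyClassNumberX10bPinned) :
    TwoSidedLinkAnyClassNumberX10b := by
  intro W _ _ p _ _ K _ _ hX hns hcm hK hodd h3 hHN hHp hirr ι κ hκ γ _ Dt hc H ιC P hP hrk hfin hnt _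
  exact hB W p K hX hns hcm hK hodd h3 hHN hHp hirr ι κ hκ γ Dt hc H ιC P hP hrk hfin hnt
    (hA W p K hX hns hcm hK h3 (discr_ne_neg_four_of_odd hodd) hHN hHp κ hκ γ Fact.out Dt H ιC hc)

/-- **Converse direction of the sandwich: the untied aside 23730 implies the pinned B₃^pin (stmt-26622)** —
a TIED containment `F.Dt = Dt ∧ …` is in particular an untied one (drop the tie). Together with
`twoSidedLinkAnyClassNumberX10b_of_pinnedTwins`: `B₃^pin ⟸ B₃ ⟸ A₃^pin ∧ B₃^pin`, i.e. granted A₃^pin the untied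
and pinned B-statements are equivalent. Pure glue (plan g9's Sketch `twoSidedLinkX10bPinned_of_raw`, landed). -/
theorem twoSidedLinkAnyClassNumberX10bPinned_of_untied (hB : TwoSidedLinkAnyClassNumberX10b) :
    TwoSidedLinkAnyClassNumberX10bPinned := by
  intro W _ _ p _ _ K _ _ hX hns hcm hK hodd h3 hHN hHp hirr ι κ hκ γ _ Dt hc H ιC P hP hrk hfin hnt hEx
  obtain ⟨jbar, D, F, X, -, hle⟩ := hEx
  exact hB W p K hX hns hcm hK hodd h3 hHN hHp hirr ι κ hκ γ Dt hc H ιC P hP hrk hfin hnt ⟨jbar, D, F, X, hle⟩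

/-- **23730 from A₃^pin and the two print bundles**, through the landed B₃ door
`twoSidedLinkAnyClassNumberX10bPinnedOfPrint_holds` (stmt-26624 CLOSED, p613989):
`HowardContainmentAnyClassNumberX10bPinned → PinnedTransferPrintFacts → HeegnerPrintFactsX10b →
TwoSidedLinkAnyClassNumberX10b`. Glue over named print facts; beyond-print theorem: no.
[cite: YanZhu2024MainConjNonCM, Thm. 5.7 (1) and Thm. 5.9] [cite: BurungaleCastellaSkinner2025, Prop. 4.2.2]
[cite: CastellaGrossiLeeSkinner2022, Thm. 5.1.3] [cite: JetchevSkinnerWan2017, Thm. 3.3.1] -/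
theorem twoSidedLinkAnyClassNumberX10b_of_pinnedContainment_of_printFacts
    (hA : HowardContainmentAnyClassNumberX10bPinned) (hPT : PinnedTransferPrintFacts)
    (hHP : HeegnerPrintFactsX10b) : TwoSidedLinkAnyClassNumberX10b :=
  twoSidedLinkAnyClassNumberX10b_of_pinnedTwins hA
    (twoSidedLinkAnyClassNumberX10bPinnedOfPrint_holds hPT hHP)

/-- **23730 lies in the cone of the deciding crux**: from EXACTLY the binders of the route's `closes` (rev 21) —
the deciding crux `HowardContainmentAnyClassNumberX10bPinnedOfPrint` (stmt-26623) with its three print inputs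
`MastellaZermanHowardDivisibility` (hMZ), `CGLSHowardDivisibilityLocalized` (hCGLS),
`AnticyclotomicTowerInRingClassFields` (hTw), and the B-door inputs `PinnedTransferPrintFacts` (hPT),
`HeegnerPrintFactsX10b` (hHP) — the untied aside `TwoSidedLinkAnyClassNumberX10b` follows. Hence 23730 closes
BY NAME the moment 26623 does; no separate work is owed on it. Pure glue. -/
theorem twoSidedLinkAnyClassNumberX10b_of_closesBinders
    (hA3 : HowardContainmentAnyClassNumberX10bPinnedOfPrint) (hMZ : MastellaZermanHowardDivisibility)
    (hCGLS : CGLSHowardDivisibilityLocalized) (hTw : AnticyclotomicTowerInRingClassFields)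
    (hPT : PinnedTransferPrintFacts) (hHP : HeegnerPrintFactsX10b) : TwoSidedLinkAnyClassNumberX10b :=
  twoSidedLinkAnyClassNumberX10b_of_pinnedContainment_of_printFacts (hA3 hMZ hCGLS hTw) hPT hHP

/-- **The `3 ∤ h_K` slice of 23730 from PRINT** (modulo the cite-only bundles the route already binds): on every
B₃ frame with `¬ p ∣ h_K`, Mastella–Zerman 2026 Cor. 4.6 (`hMZ`, the route item `MastellaZermanHowardDivisibility`
= the body of `MastellaZerman2026.cor46_howardDivisibility_of_scalarImage` at universe 0) yields the PINNED
containment for the frame's own datum (`X10.heegnerContainmentPinned_of_cor46_of_not_surj`, p607508; scalars in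
the image from `¬ Surj W 3`, Lombardo–Tronto), and the landed B₃ door turns it into the two-sided link
`X11b.IMCWaldspurgerOnTreeGoodAt p κ (inducedPlace ι) γ ι P` — WITHOUT using the untied `∃`-hypothesis of 23730
(which is therefore omitted from the binder list; everything else is 23730's binder list verbatim plus
`¬ p ∣ NumberField.classNumber K`). What 23730 asks beyond this slice is the `3 ∣ h_K` pinned containment (the
A-side deciding content), nothing on the B side. Glue over named print facts; beyond-print theorem: no.
[cite: MastellaZerman2026, Cor. 4.6] [cite: LombardoTronto2022, Prop. 3.12]
[cite: YanZhu2024MainConjNonCM, Thm. 5.7 (1) and Thm. 5.9] [cite: BurungaleCastellaSkinner2025, Prop. 4.2.2]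
[cite: CastellaGrossiLeeSkinner2022, Thm. 5.1.3] [cite: JetchevSkinnerWan2017, Thm. 3.3.1] -/
theorem twoSidedLinkAnyClassNumberX10b_coprimeClassNumber_of_printFacts
    (hMZ : MastellaZermanHowardDivisibility) (hPT : PinnedTransferPrintFacts) (hHP : HeegnerPrintFactsX10b)
    (W : WeierstrassCurve ℚ) [W.IsElliptic] [W.IsGloballyMinimal] (p : ℕ) [Fact p.Prime]
    [NeZero (W.conductorNorm ℤ)] (K : Type) [Field K] [NumberField K]
    (hX : Literature.NumberTheory.EllipticCurves.Rank1Residual.ClassX10 W p)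
    (hns : ¬ Literature.NumberTheory.EllipticCurves.Rank1Residual.Surj W 3) (hcm : ¬ W.HasCM)
    (hK : Literature.NumberTheory.EllipticCurves.IsImaginaryQuadratic K) (hodd : Odd (NumberField.discr K))
    (h3 : NumberField.discr K ≠ -3)
    (hHN : Literature.NumberTheory.EllipticCurves.SatisfiesHeegnerHypothesis (W.conductorNorm ℤ) K)
    (hHp : Literature.NumberTheory.EllipticCurves.SatisfiesHeegnerHypothesis p K)
    (hirr : (W.baseChange K).HasIrreducibleModPGaloisRep p)
    (hhK : ¬ p ∣ NumberField.classNumber K) (ι : K →+* ℚ_[p])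
    (κ : Literature.NumberTheory.EllipticCurves.ZpExtension K p) (hκ : κ.IsAnticyclotomic)
    (γ : Field.absoluteGaloisGroup K) [Fact (κ.IsTopGenerator γ)]
    (Dt : Literature.NumberTheory.EllipticCurves.ModularForms.ModularParametrizationData W (W.conductorNorm ℤ))
    (hc : ¬ (p : ℤ) ∣ Dt.c)
    (H : Literature.NumberTheory.EllipticCurves.HeegnerDatum (W.conductorNorm ℤ) (NumberField.discr K))
    (ιC : K →+* ℂ) (P : (W.baseChange K).toAffine.Point)
    (hP : WeierstrassCurve.Affine.Point.map ιC.toRatAlgHom P =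
      Literature.NumberTheory.EllipticCurves.ModularForms.heegnerPointComplex Dt H)
    (hrk : (W.baseChange K).mordellWeilRank = 1)
    (hfin : Finite (AddCommGroup.primaryComponent (W.baseChange K).sha p)) (hnt : ¬ IsOfFinAddOrder P) :
    Summit.BirchSwinnertonDyer.Rank1Residual.X11b.IMCWaldspurgerOnTreeGoodAt p κ
      (Summit.BirchSwinnertonDyer.Rank1Residual.X11b.inducedPlace ι) γ ι P := by
  obtain ⟨jbar⟩ := nonempty_ringHom_algebraicClosure_complex K ιC
  obtain ⟨D, F, X, hFD, -, hle⟩ := X10.heegnerContainmentPinned_of_cor46_of_not_surj hMZ hX hns hcm hK h3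
    (discr_ne_neg_four_of_odd hodd) hHN hHp hhK κ hκ γ Fact.out Dt H jbar
  exact twoSidedLinkAnyClassNumberX10bPinnedOfPrint_holds hPT hHP W p K hX hns hcm hK hodd h3 hHN hHp hirr ι κ
    hκ γ Dt hc H ιC P hP hrk hfin hnt ⟨jbar, D, F, X, hFD, hle⟩


/-! ### Appended (x10b-p3 g3, 2026-08-28): the LIGHT A-side equally supersedes 23730 — ROUTE-TEXT-FREE

PrintX10b rev 27–33 (plan g9, 2026-08-28T09:3xZ) re-typed the A-side to the LIGHT frame
`HowardContainmentLightFrameX10bPinned` (stmt-27274) = PrintX9's `HowardContainmentLightFramePinned` (stmt-26356)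
with `ClassX9 W p` replaced by `ClassX10 W p → ¬ Surj W 3 → ¬ W.HasCM`: the TIED containment on rank-one X10b
frames with `Ш(E/K)[p^∞]` finite, `(E/K)[p]` irreducible, odd `d_K`; new DECIDING crux
`HowardContainmentLightFrameX10bPinnedOfPrint` (stmt-27275) := MZ → NV → CGS → Tower♯ → A-light. Every LIGHT
hypothesis is a binder of B₃, so the LIGHT A-side and B₃^pin again give the untied aside 23730 — first
ROUTE-TEXT-FREE (the LIGHT text spelled out as the hypothesis `hA`), then BY NAME, then from exactly the binders of
the rev-33 `closes`. -/

/-- **23730 from the LIGHT pinned A-side and B₃^pin (route-text-free).** `hA` is the announced LIGHT X10b text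
verbatim (PrintX9 stmt-26356's body with `ClassX9` ↦ `ClassX10 ∧ ¬Surj₃ ∧ ¬CM`): on every rank-one X10b Heegner frame
with `Ш(E/K)[p^∞]` finite, `(E/K)[p]` irreducible, odd `d_K ≠ -3`, `p ∤ c(Dt)`, the TIED containment
`∃ jbar D F X, F.Dt = Dt ∧ I(ℋ_F)² ⊆ char_Λ(X_tors)`. With `TwoSidedLinkAnyClassNumberX10bPinned` (stmt-26622) it
yields `TwoSidedLinkAnyClassNumberX10b` (stmt-23730); the untied hypothesis of 23730 is discarded. Pure glue. -/
theorem twoSidedLinkAnyClassNumberX10b_of_lightContainment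
    (hA : ∀ (W : WeierstrassCurve ℚ) [W.IsElliptic] [W.IsGloballyMinimal] (p : ℕ) [Fact p.Prime]
      [NeZero (W.conductorNorm ℤ)] (K : Type) [Field K] [NumberField K],
      Literature.NumberTheory.EllipticCurves.Rank1Residual.ClassX10 W p →
      ¬ Literature.NumberTheory.EllipticCurves.Rank1Residual.Surj W 3 → ¬ W.HasCM →
      Literature.NumberTheory.EllipticCurves.IsImaginaryQuadratic K → Odd (NumberField.discr K) →
      NumberField.discr K ≠ -3 →
      Literature.NumberTheory.EllipticCurves.SatisfiesHeegnerHypothesis (W.conductorNorm ℤ) K →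
      Literature.NumberTheory.EllipticCurves.SatisfiesHeegnerHypothesis p K →
      (W.baseChange K).HasIrreducibleModPGaloisRep p →
      ∀ (κ : Literature.NumberTheory.EllipticCurves.ZpExtension K p), κ.IsAnticyclotomic →
      ∀ (γ : Field.absoluteGaloisGroup K), κ.IsTopGenerator γ →
      ∀ (Dt : Literature.NumberTheory.EllipticCurves.ModularForms.ModularParametrizationData W (W.conductorNorm ℤ))
        (H : Literature.NumberTheory.EllipticCurves.HeegnerDatum (W.conductorNorm ℤ) (NumberField.discr K))
        (ιC : K →+* ℂ), ¬ (p : ℤ) ∣ Dt.c → (W.baseChange K).mordellWeilRank = 1 →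
      Finite (AddCommGroup.primaryComponent (W.baseChange K).sha p) →
      ∃ (jbar : AlgebraicClosure K →+* ℂ) (D : (W.baseChange K).LambdaAdicSelmerData κ γ)
        (F : Literature.NumberTheory.EllipticCurves.HeegnerFamily (W.conductorNorm ℤ) W K κ jbar)
        (X : (W.baseChange K).SelmerDualData κ γ), F.Dt = Dt ∧
        Literature.NumberTheory.EllipticCurves.heegnerCharIdeal D F ^ 2 ≤
          Literature.NumberTheory.EllipticCurves.Module.charIdeal
            (Literature.NumberTheory.EllipticCurves.IwasawaAlgebra p)
            (Submodule.torsion (Literature.NumberTheory.EllipticCurves.IwasawaAlgebra p) X.X))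
    (hB : TwoSidedLinkAnyClassNumberX10bPinned) : TwoSidedLinkAnyClassNumberX10b := by
  intro W _ _ p _ _ K _ _ hX hns hcm hK hodd h3 hHN hHp hirr ι κ hκ γ _ Dt hc H ιC P hP hrk hfin hnt _
  exact hB W p K hX hns hcm hK hodd h3 hHN hHp hirr ι κ hκ γ Dt hc H ιC P hP hrk hfin hnt
    (hA W p K hX hns hcm hK hodd h3 hHN hHp hirr κ hκ γ Fact.out Dt H ιC hc hrk hfin)

/-- **23730 from the LIGHT pinned twins, BY NAME** (PrintX10b rev 33): `HowardContainmentLightFrameX10bPinned`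
(stmt-27274) and `TwoSidedLinkAnyClassNumberX10bPinned` (stmt-26622) imply `TwoSidedLinkAnyClassNumberX10b`
(stmt-23730). The item's body is letter for letter the hypothesis of
`twoSidedLinkAnyClassNumberX10b_of_lightContainment`. Pure glue. -/
theorem twoSidedLinkAnyClassNumberX10b_of_lightTwins
    (hA : HowardContainmentLightFrameX10bPinned) (hB : TwoSidedLinkAnyClassNumberX10bPinned) :
    TwoSidedLinkAnyClassNumberX10b :=
  twoSidedLinkAnyClassNumberX10b_of_lightContainment hA hB

/-- **23730 lies in the cone of the rev-33 deciding crux**: from EXACTLY the binders of the route's `closes`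
(PrintX10b rev 33) — the deciding crux `HowardContainmentLightFrameX10bPinnedOfPrint` (stmt-27275) with its four
print inputs `MastellaZermanHowardDivisibility` (hMZ), `CGLSHeegnerClassNonvanishing` (hNV, stmt-27103),
`CGSHowardDivisibilityPLocalized` (hCGS, stmt-27112), `AnticyclotomicTowerSharp` (hTw, stmt-27076), and the
B-door inputs `PinnedTransferPrintFacts` (hPT), `HeegnerPrintFactsX10b` (hHP) through the landed door
`twoSidedLinkAnyClassNumberX10bPinnedOfPrint_holds` (p613989) — the untied aside `TwoSidedLinkAnyClassNumberX10b`
follows. Hence 23730 closes BY NAME the moment 27275 does; no separate work is owed on it. Glue over named print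
facts; beyond-print theorem: no. [cite: MastellaZerman2026, Cor. 4.6] [cite: CastellaGrossiLeeSkinner2022,
Thm. 4.1.1 and Rem. 4.1.4] [cite: CastellaGrossiSkinner2025, Thm. 6.5.2] [cite: PerrinRiou1987BSMF, §3.2]
[cite: YanZhu2024MainConjNonCM, Thm. 5.7 (1) and Thm. 5.9] [cite: BurungaleCastellaSkinner2025, Prop. 4.2.2]
[cite: CastellaGrossiLeeSkinner2022, Thm. 5.1.3] [cite: JetchevSkinnerWan2017, Thm. 3.3.1] -/
theorem twoSidedLinkAnyClassNumberX10b_of_lightClosesBinders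
    (hA3 : HowardContainmentLightFrameX10bPinnedOfPrint) (hMZ : MastellaZermanHowardDivisibility)
    (hNV : CGLSHeegnerClassNonvanishing) (hCGS : CGSHowardDivisibilityPLocalized)
    (hTw : AnticyclotomicTowerSharp) (hPT : PinnedTransferPrintFacts) (hHP : HeegnerPrintFactsX10b) :
    TwoSidedLinkAnyClassNumberX10b :=
  twoSidedLinkAnyClassNumberX10b_of_lightTwins (hA3 hMZ hNV hCGS hTw)
    (twoSidedLinkAnyClassNumberX10bPinnedOfPrint_holds hPT hHP)

end Summit.BirchSwinnertonDyer.BirchSwinnertonDyer.Theorems.PrintX10bPinned
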